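import Literature.AnabelianGeometry.EtaleTheta.Discharge.Sec2TemperedCoverDataModelTheta
import Literature.AnabelianGeometry.EtaleTheta.ThetaCoversTempered
import Literature.AnabelianGeometry.EtaleTheta.Discharge.Sec2ProfiniteCompletion
import HarnessLib

/-!
# A MODEL of `ThetaCovers.TemperedCoverData` ([EtTh] §2, Def. 2.5), part 3: the tempered layer
# `Π^tp_C = A × ℤ ↪ Π_C = Â × Ẑ`, the coverings `Y`, `Ÿ`, `Ċ`, and the inhabitant

S. Mochizuki, *The étale theta function …*, Publ. RIMS **45** (2009) [MochizukiEtTh2009], §2, Def. 2.5 pp.39–40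
(PDF): the tempered fundamental group `Π^tp_C`, "the natural quotient `Π^tp_X ↠ Z`" (`Y`, p.39), `Ÿ` (p.40), `Ċ`
(Def. 1.7).  abc-iut cell, layer L2, L2-lead R125 → seat abc-iut-w5-d118 («NV-L2/TemperedCoverData MODEL»).
CONSISTENCY WITNESS / TOY (continuation of `ThetaCoversTemperedModelDefs.lean` and
`Discharge/Sec2TemperedCoverDataModelTheta.lean`, same honest labels); PROOF-ONLY (0 definitions): the inhabitant
is the structure literal inside `exists_model`, recorded with its computed cusp data.

THE TEMPERED LAYER: `Π^tp_C := A × ℤ` (discrete; `A = heisPiC l × ℤ/2`), `Π^tp_C ↪ Π_C = Â × Ẑ` the product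
of the canonical maps into the profinite completions — injective (both factors residually finite) and a profinite
completion in abc-iut-L3's sense (`isProfiniteCompletion_prodMap_etaCont`, abc-iut-L2-t1); `Π^tp_X = A_X × ℤ` with
`A_X := heisPiX × ℤ/2`; `Π^tp_Y := A_X × {0}` (so `Π^tp_X/Π^tp_Y ≅ ℤ`: the TATE direction); `Π^tp_Ÿ := (heisPiX × 1) × {0}`
(index `2` in `Π^tp_Y`: the `ℤ/2` coordinate); `Π^tp_Ċ := (heisPiC l × 1) × ℤ` (index `2`, `≠ Π^tp_X`).
The abc-iut-L2 census (`INHABITATION-CENSUS-L2`, abc-iut-w5-d197/w5-d029) listed `ThetaCovers.TemperedCoverData` with ZERO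
producers; `nonempty_temperedCoverData` clears it; `exists_model` records the model's cusp data and
`not_forall_hC1` / `not_forall_cor29_card` are the kernel certificate that the cusp hypothesis `hC1` of [EtTh] Cor. 2.9
(hence abc-iut-L2-t2's typed `Cor29_card`) is NOT derivable from the typed interface (GAP-LEDGER G-L2d3-2).
[cite: MochizukiEtTh2009, Def 2.5 p.39]
-/

noncomputable section

namespace Literature.AnabelianGeometry.EtaleTheta

namespace ThetaCovers

namespace TemperedModel

open Multiplicative HeisenbergWitness Literature.AnabelianGeometry.SemiGraphs
  Literature.AnabelianGeometry.EtaleTheta.SettingModel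

variable (l : ℕ) [NeZero l]

/-! ## 1. Subgroups of `Π^tp_C = A × ℤ` -/

omit [NeZero l] in
/-- `A_X` is normal (index `2`). (toy bookkeeping) [cite: MochizukiEtTh2009, Def 2.5 p.39] -/
theorem TAX_normal : (TAX l).Normal := by
  haveI : (heisPiX l).Normal := MonoidHom.normal_ker _
  exact Subgroup.Normal.comap inferInstance _

omit [NeZero l] in
/-- `Π^tp_C ↪ Π_C` on elements. (toy bookkeeping) [cite: MochizukiEtTh2009, Def 2.5 p.39] -/
theorem toHatM_apply (a : TA l) (n : Multiplicative ℤ) :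
    toHatM l (a, n) = (etaCont (TA l) a, etaCont (Multiplicative ℤ) n) := rfl

/-- **`Π^tp_X = A_X × ℤ`**: the inverse image of `Π_X ⊆ Π_C` in `Π^tp_C`. (toy bookkeeping) [cite: MochizukiEtTh2009, Def 2.5 p.39] -/
theorem comap_toHatM_PiXM : (PiXM l).comap (toHatM l).toMonoidHom = (TAX l).prod ⊤ := by
  ext ⟨a, n⟩
  rw [Subgroup.mem_prod]
  change Phi l (toHatM l (a, n)) ∈ heisPiX l ↔ a.1 ∈ heisPiX l ∧ n ∈ (⊤ : Subgroup (Multiplicative ℤ))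
  rw [toHatM_apply, Phi_eta]
  exact ⟨fun h => ⟨h, trivial⟩, fun h => h.1⟩

/-- `η_A` is injective (`A` is finite, hence residually finite). (toy bookkeeping) [cite: MochizukiEtTh2009, Def 2.5 p.39] -/
theorem etaCont_TA_injective : Function.Injective (etaCont (TA l)) :=
  (ProfiniteGrp.ProfiniteCompletion.etaFn_injective_iff_residuallyFinite (GrpCat.of (TA l))).mpr
    (inferInstanceAs (Group.ResiduallyFinite (TA l)))

omit [NeZero l] in
/-- `η_ℤ` is injective (`ℤ` is free, hence residually finite). (toy bookkeeping) [cite: MochizukiEtTh2009, Def 2.5 p.39] -/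
theorem etaCont_int_injective : Function.Injective (etaCont (Multiplicative ℤ)) := by
  haveI : IsFreeGroup (Multiplicative ℤ) := IsFreeGroup.ofMulEquiv (FreeGroup.mulEquivIntOfUnique (α := Unit))
  haveI : Group.ResiduallyFinite (Multiplicative ℤ) :=
    DiscreteNormalizers.residuallyFinite_of_isFreeGroup (Multiplicative ℤ)
  exact (ProfiniteGrp.ProfiniteCompletion.etaFn_injective_iff_residuallyFinite
    (GrpCat.of (Multiplicative ℤ))).mpr inferInstance

/-- **`Π^tp_C ↪ Π_C` is injective.** (toy bookkeeping) [cite: MochizukiEtTh2009, Def 2.5 p.39] -/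
theorem toHatM_injective : Function.Injective (toHatM l) := fun _ _ h =>
  Prod.ext (etaCont_TA_injective l (congrArg Prod.fst h)) (etaCont_int_injective (congrArg Prod.snd h))

/-- Membership in `Π^tp_X = A_X × ℤ`. (toy bookkeeping) [cite: MochizukiEtTh2009, Def 2.5 p.39] -/
theorem mem_comap_toHatM_PiXM (x : GtpM l) : x ∈ (PiXM l).comap (toHatM l).toMonoidHom ↔ x.1 ∈ TAX l := by
  rw [comap_toHatM_PiXM, Subgroup.mem_prod]
  exact ⟨fun h => h.1, fun h => ⟨h, trivial⟩⟩

/-- **`Π^tp_X / Π^tp_Y ≅ ℤ`** for `Π^tp_Y := A_X × {0}` (the Tate quotient `Z`, p.39). (toy bookkeeping)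
[cite: MochizukiEtTh2009, Def 2.5 p.39] -/
theorem nonempty_quotZ [((TAX l).prod (⊥ : Subgroup (Multiplicative ℤ))).Normal] :
    Nonempty (↥((PiXM l).comap (toHatM l).toMonoidHom) ⧸
      (((TAX l).prod (⊥ : Subgroup (Multiplicative ℤ))).subgroupOf ((PiXM l).comap (toHatM l).toMonoidHom)) ≃*
        Multiplicative ℤ) := by
  let K : Subgroup (GtpM l) := (PiXM l).comap (toHatM l).toMonoidHom
  let f : ↥K →* Multiplicative ℤ := (MonoidHom.snd _ _).comp (Subgroup.subtype _)
  have hf : Function.Surjective f := fun n =>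
    ⟨⟨(1, n), (mem_comap_toHatM_PiXM l _).mpr (TAX l).one_mem⟩, rfl⟩
  have hker : f.ker = ((TAX l).prod (⊥ : Subgroup (Multiplicative ℤ))).subgroupOf K := by
    ext ⟨⟨a, n⟩, ha⟩
    rw [MonoidHom.mem_ker, Subgroup.mem_subgroupOf, Subgroup.mem_prod, Subgroup.mem_bot]
    exact ⟨fun h => ⟨(mem_comap_toHatM_PiXM l _).mp ha, h⟩, fun h => h.2⟩
  exact ⟨(QuotientGroup.quotientMulEquivOfEq hker.symm).trans (QuotientGroup.quotientKerEquivOfSurjective f hf)⟩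

omit [NeZero l] in
/-- **`[Π^tp_Y : Π^tp_Ÿ] = 2`** for `Π^tp_Ÿ := (heisPiX × 1) × {0}` (the `ℤ/2`-coordinate). (toy bookkeeping)
[cite: MochizukiEtTh2009, Def 2.5 p.40] -/
theorem relIndex_PiYddtp : (((TAX l ⊓ (TA.two l).ker)).prod (⊥ : Subgroup (Multiplicative ℤ))).relIndex
    ((TAX l).prod ⊥) = 2 := by
  let g : ↥((TAX l).prod (⊥ : Subgroup (Multiplicative ℤ))) →* Multiplicative (ZMod 2) :=
    (TA.two l).comp ((MonoidHom.fst _ _).comp (Subgroup.subtype _))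
  have hg : Function.Surjective g := fun y =>
    ⟨⟨(TA.mk l 1 y, 1), ⟨show (1 : heisPiC l) ∈ heisPiX l from (heisPiX l).one_mem, rfl⟩⟩, rfl⟩
  have hker : g.ker = (((TAX l ⊓ (TA.two l).ker)).prod (⊥ : Subgroup (Multiplicative ℤ))).subgroupOf
      ((TAX l).prod ⊥) := by
    ext ⟨⟨a, n⟩, ha⟩
    rw [MonoidHom.mem_ker, Subgroup.mem_subgroupOf, Subgroup.mem_prod, Subgroup.mem_inf, MonoidHom.mem_ker]
    exact ⟨fun h => ⟨⟨ha.1, h⟩, ha.2⟩, fun h => h.1.2⟩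
  change ((((TAX l ⊓ (TA.two l).ker)).prod (⊥ : Subgroup (Multiplicative ℤ))).subgroupOf ((TAX l).prod ⊥)).index = 2
  rw [← hker, Subgroup.index_ker, MonoidHom.range_eq_top.mpr hg, Subgroup.card_top, Nat.card_eq_fintype_card,
    Fintype.card_multiplicative, ZMod.card]

omit [NeZero l] in
/-- **`[Π^tp_C : Π^tp_Ċ] = 2`** for `Π^tp_Ċ := Ker(ℤ/2-coordinate) × ℤ`. (toy bookkeeping) [cite: MochizukiEtTh2009, Def 2.5 p.39] -/
theorem index_PiCdot : (((TA.two l).ker).prod (⊤ : Subgroup (Multiplicative ℤ))).index = 2 := by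
  have hsurj : Function.Surjective (TA.two l) := fun y => ⟨TA.mk l 1 y, rfl⟩
  rw [Subgroup.index_prod, Subgroup.index_top, mul_one, Subgroup.index_ker, MonoidHom.range_eq_top.mpr hsurj,
    Subgroup.card_top, Nat.card_eq_fintype_card, Fintype.card_multiplicative, ZMod.card]

/-- `Π^tp_Ċ ≠ Π^tp_X` (the element `((s, 1), 0)`). (toy bookkeeping) [cite: MochizukiEtTh2009, Def 2.5 p.39] -/
theorem PiCdot_ne : ((TA.two l).ker).prod (⊤ : Subgroup (Multiplicative ℤ)) ≠ (PiXM l).comap (toHatM l).toMonoidHom := by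
  intro h
  have hw : ((TA.mk l (SemidirectProduct.inr (DihedralGroup.sr 0)) 1, 1) : GtpM l) ∈
      ((TA.two l).ker).prod (⊤ : Subgroup (Multiplicative ℤ)) := ⟨rfl, trivial⟩
  rw [h, comap_toHatM_PiXM, Subgroup.mem_prod] at hw
  obtain ⟨i, hi⟩ := (mem_heisPiX l).mp hw.1
  cases hi

/-! ## 2. Cusp data of the model: `Δ̄_Θ-preimage` is central modulo `Ker`, and `D_x` is normal -/

omit [NeZero l] in
/-- In the toy, `heisTheta` is central in the whole of `heisPiC l` (rotations act by `c ↦ c + i·b` with `b = 0`,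
reflections trivially). (toy bookkeeping) [cite: MochizukiEtTh2009, Rmk 2.6.1 p.40] -/
theorem heis_theta_central (hl : Odd l) (c : heisPiC l) {t : heisPiC l} (ht : t ∈ heisTheta l) :
    c * t * c⁻¹ * t⁻¹ = 1 := by
  by_cases hc : c ∈ heisPiX l
  · -- `t d t⁻¹ d⁻¹ = 1` for `d ∈ heisPiX` gives `d t d⁻¹ t⁻¹ = 1`
    have h := heis_central l hl ht hc
    have : c * t * c⁻¹ * t⁻¹ = (t * c * t⁻¹ * c⁻¹)⁻¹ := by group
    rw [this, h, inv_one]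
  · exact heis_inv_theta l hl hc ht

/-- **`K ⊇ μ_l` holds in the model** (`HasMuL`: all of `Π_C` centralises `Δ̄_Θ` modulo `Ker`) — so [EtTh] Cor. 2.9's
cardinality statement is NOT vacuously true there. (toy bookkeeping) [cite: MochizukiEtTh2009, Cor 2.9 p.43] -/
theorem hasMuL_model (hl : Odd l) (c : PiCM l) {t : PiCM l} (ht : t ∈ barThetaM l) :
    c * t * c⁻¹ * t⁻¹ ∈ barKerM l := by
  refine ⟨?_, Psi_comm_mem_ker l c t⟩
  change Phi l (c * t * c⁻¹ * t⁻¹) ∈ heisTheta l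
  rw [map_mul, map_mul, map_mul, map_inv, map_inv, heis_theta_central l hl (Phi l c) ht]
  exact (heisTheta l).one_mem

/-- `D_x = Δ̄_Θ-preimage` is NORMAL in `Π_C` (the model's cusp decomposition group is as degenerate as the
interface allows). (toy bookkeeping) [cite: MochizukiEtTh2009, Cor 2.9 p.43] -/
theorem barThetaM_normal : (barThetaM l).Normal := (heisTheta_normal l).comap _

/-- The element `((r¹, 1), 0) ∈ Π^tp_X` of the model is NOT in `Π^tp_{C̲}`-preimage `Φ⁻¹(heisPiCu)` when `l ≠ 1`
(`r¹ ∉ {1, s}`). (toy bookkeeping) [cite: MochizukiEtTh2009, Cor 2.9 p.43] -/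
theorem rotOne_not_mem_HpM (hl1 : l ≠ 1) :
    toHatM l (TA.mk l (SemidirectProduct.inr (DihedralGroup.r 1)) 1, 1) ∉ HpM l := by
  intro h
  have h' : Phi l (toHatM l (TA.mk l (SemidirectProduct.inr (DihedralGroup.r 1)) 1, 1)) ∈ heisPiCu l := h
  rw [toHatM_apply, Phi_eta] at h'
  change SemidirectProduct.inr (DihedralGroup.r 1) ∈ heisPiCu l at h'
  rcases h' with h1 | h1
  · rw [SemidirectProduct.right_inr, DihedralGroup.one_def, DihedralGroup.r.injEq] at h1
    exact hl1 ((ZMod.one_eq_zero_iff (n := l)).mp h1)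
  · rw [SemidirectProduct.right_inr] at h1
    cases h1

/-- `Π_C̲̲ ⊆ Π_C̲` in the model (`Ker, E ⊆ Π_X̲ ⊆ Π_C̲`, `ι̲ ∈ Π_C̲`). (toy bookkeeping) [cite: MochizukiEtTh2009, Def 2.3 p.38] -/
theorem PiCuuM_le_HpM : PiCuuM l ≤ HpM l := by
  have hι : iotaM l ∈ HpM l := by
    change Phi l (iotaM l) ∈ heisPiCu l
    rw [Phi_iotaM]
    exact Or.inr rfl
  refine sup_le (sup_le (inf_le_left.trans ((barThetaM_le_HpM_inf l).trans inf_le_left))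
    (inf_le_left.trans inf_le_left)) ?_
  rw [Subgroup.zpowers_le]
  exact hι

/-! ## 3. The inhabitant and the independence certificate for the cusp hypotheses of Cor. 2.9 -/

/-- **THE MODEL, with its cusp data computed** (proof-only packaging: the inhabitant is the structure literal
below; the record of its properties is this ∃-statement).  For every odd `l ≠ 1` there is a
`T : ThetaCovers.TemperedCoverData l` — the model «Heisenberg ⋊ D_l × Tate ℤ ⊆ Ẑ», `G_K = 1` — such that
(1) `K ⊇ μ_l` holds (`HasMuL`); (2) the cusp stabiliser `cuspStabC = N_{Π^tp_C}(tp D_x)` is ALL of `Π^tp_C`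
(`D_x` is normal in the model); hence (3) the hypothesis `hC2` of [EtTh] Cor. 2.9's discharge
(`¬ cuspStabC ≤ Π^tp_X`) HOLDS, but (4) the hypothesis `hC1` (`cuspStabC ∩ Π^tp_X ⊆ Π^tp_{X̲}`) FAILS
(`((r¹,1),0) ∈ Π^tp_X ∖ Π^tp_{C̲}`), and (5) every member has exactly ONE `Aut_K`-orbit of cusps.
CONSISTENCY WITNESS: the typed interface `TemperedCoverData` is jointly satisfiable; INDEPENDENCE CERTIFICATE
(GAP-LEDGER G-L2d3-2): `hC1` — hence the `D^tp_{x_C}` binders (B1)–(B3) of `Sec2CuspDecompositionReduction.lean`,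
which imply it — is NOT derivable from the interface as typed. [cite: MochizukiEtTh2009, Cor 2.9 p.43] -/
theorem exists_model (hl : Odd l) (hl1 : l ≠ 1) : ∃ T : TemperedCoverData.{0} l,
    T.HasMuL ∧ T.cuspStabC = ⊤ ∧ ¬ T.cuspStabC ≤ T.tp T.PiX ∧ ¬ (T.cuspStabC ⊓ T.tp T.PiX ≤ T.tp T.PiXu) ∧
      ∀ S : Subgroup T.Gtp, Nat.card (T.cuspOrbits S) = 1 := by
  haveI := TAX_normal l
  haveI : ((TAX l).prod (⊥ : Subgroup (Multiplicative ℤ))).Normal := Subgroup.prod_normal _ _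
  let T : TemperedCoverData.{0} l :=
    { toCoverDataAx := coverDataAx l hl
      PiCuu := PiCuuM l
      isTypeLTorsThetaPm := isTypeLTorsThetaPm_PiCuuM l hl
      isOpen_PiCuu' := isOpen_PiCuuM l
      Gtp := GtpM l
      toHat := (toHatM l).toMonoidHom
      continuous_toHat := (toHatM l).continuous
      injective_toHat := toHatM_injective l
      isProfiniteCompletion_toHat := isProfiniteCompletion_prodMap_etaCont (TA l) (Multiplicative ℤ)
      PiYtp := (TAX l).prod ⊥
      PiYtp_le := by
        change (TAX l).prod ⊥ ≤ (PiXM l).comap (toHatM l).toMonoidHom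
        rw [comap_toHatM_PiXM]
        exact Subgroup.prod_mono le_rfl bot_le
      PiYtp_normal := inferInstance
      isOpen_PiYtp := isOpen_discrete _
      quotZ := nonempty_quotZ l
      PiYddtp := ((TAX l ⊓ (TA.two l).ker)).prod ⊥
      PiYddtp_le := Subgroup.prod_mono inf_le_left le_rfl
      isOpen_PiYddtp := isOpen_discrete _
      relIndex_PiYddtp := relIndex_PiYddtp l
      PiCdot := ((TA.two l).ker).prod ⊤
      index_PiCdot := index_PiCdot l
      isOpen_PiCdot := isOpen_discrete _
      PiCdot_ne := PiCdot_ne l }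
  -- (2) the cusp stabiliser is everything: `tp D_x` is normal
  have hN : (T.tp T.Dx).Normal := by
    change ((barThetaM l).comap (toHatM l).toMonoidHom).Normal
    haveI := barThetaM_normal l
    exact Subgroup.Normal.comap inferInstance _
  have hstab : T.cuspStabC = ⊤ := by
    change Subgroup.normalizer ((T.tp T.Dx : Subgroup T.Gtp) : Set T.Gtp) = ⊤
    exact Subgroup.normalizer_eq_top_iff.mpr hN
  -- the witness `((r¹, 1), 0) ∈ Π^tp_X ∖ Π^tp_{C̲}`
  have hgX : (TA.mk l (SemidirectProduct.inr (DihedralGroup.r 1)) 1, (1 : Multiplicative ℤ)) ∈ T.tp T.PiX := by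
    change _ ∈ (PiXM l).comap (toHatM l).toMonoidHom
    rw [mem_comap_toHatM_PiXM]
    exact (mem_heisPiX l).mpr ⟨1, rfl⟩
  have hgU : (TA.mk l (SemidirectProduct.inr (DihedralGroup.r 1)) 1, (1 : Multiplicative ℤ)) ∉ T.tp T.PiXu := by
    intro h
    -- `Π_{X̲} = (Π_{C̲̲} ∩ Π_X) · Δ̄_Θ ⊆ Π_{C̲}`
    have hle : T.PiXu ≤ HpM l :=
      sup_le (inf_le_left.trans (PiCuuM_le_HpM l)) ((barThetaM_le_HpM_inf l).trans inf_le_left)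
    exact rotOne_not_mem_HpM l hl1 (hle h)
  refine ⟨T, fun c t ht => hasMuL_model l hl c ht, hstab, ?_, ?_, fun S => ?_⟩
  · -- (3) `hC2` holds: `Π^tp_X ≠ Π^tp_C`
    rw [hstab, top_le_iff]
    intro h
    have hι : (TA.mk l (SemidirectProduct.inr (DihedralGroup.sr 0)) 1, (1 : Multiplicative ℤ)) ∈ T.tp T.PiX := by
      rw [h]; trivial
    change _ ∈ (PiXM l).comap (toHatM l).toMonoidHom at hι
    rw [mem_comap_toHatM_PiXM] at hι
    obtain ⟨i, hi⟩ := (mem_heisPiX l).mp hι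
    cases hi
  · -- (4) `hC1` fails
    rw [hstab, top_inf_eq]
    exact fun h => hgU (h hgX)
  · -- (5) one orbit of cusps: `N(S) \ Π^tp_C / Π^tp_C` is a point
    haveI : Subsingleton (T.cuspOrbits S) := by
      refine ⟨fun a b => ?_⟩
      induction a using Quotient.inductionOn with
      | _ a =>
        induction b using Quotient.inductionOn with
        | _ b =>
          refine (DoubleCoset.eq _ _ a b).mpr ⟨1, Subgroup.one_mem _, a⁻¹ * b, ?_, by group⟩
          rw [hstab]
          trivial
    exact Nat.card_unique

/-- **NV-L2/TemperedCoverData: `ThetaCovers.TemperedCoverData l` is INHABITED for every odd `l ≠ 1`.**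
(For the degenerate `l = 1` the same literal works; the census needs one.) [cite: MochizukiEtTh2009, Def 2.5 p.39] -/
theorem nonempty_temperedCoverData (hl : Odd l) (hl1 : l ≠ 1) : Nonempty (TemperedCoverData.{0} l) := by
  obtain ⟨T, -⟩ := exists_model l hl hl1
  exact ⟨T⟩

/-- **INDEPENDENCE CERTIFICATE for GAP-LEDGER G-L2d3-2**: the cusp hypothesis `hC1` of [EtTh] Cor. 2.9's
discharge (`cuspStabC ∩ Π^tp_X ⊆ Π^tp_{X̲}`, abc-iut-L2-d3 `natCard_cuspOrbits_*` / `cor29_card_of`) is NOT a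
consequence of the interface `ThetaCovers.TemperedCoverData` as typed — it fails at a model in which `K ⊇ μ_l`.
[cite: MochizukiEtTh2009, Cor 2.9 p.43] -/
theorem not_forall_hC1 (hl : Odd l) (hl1 : l ≠ 1) :
    ¬ ∀ T : TemperedCoverData.{0} l, T.HasMuL → T.cuspStabC ⊓ T.tp T.PiX ≤ T.tp T.PiXu := by
  obtain ⟨T, hmu, -, -, h1, -⟩ := exists_model l hl hl1
  exact fun h => h1 (h T hmu)

/-- **The typed `Cor29_card` is NOT a consequence of the interface**: at the model every member has ONE orbit of
cusps while `#(ℤ/lℤ)^± = (l+1)/2 ≥ 2` for `l ≥ 3` — the finding "MISSING INTERFACE FIELD" of abc-iut-L2-d3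
(GAP-LEDGER G-L2d3-2) as a kernel certificate. [cite: MochizukiEtTh2009, Cor 2.9 p.43] -/
theorem not_forall_cor29_card (hl : Odd l) (h3 : 3 ≤ l) : ¬ ∀ T : TemperedCoverData.{0} l, T.Cor29_card := by
  obtain ⟨T, hmu, -, -, -, hone⟩ := exists_model l hl (by omega)
  intro h
  have h2 := h T hmu (T.tp T.PiCu) (by simp)
  rw [hone] at h2
  omega

end TemperedModel

end ThetaCovers

end Literature.AnabelianGeometry.EtaleTheta

-- (olean self-remedy re-land 2026-08-26T08:45Z, abc-iut-w5-d118: comment-only, declarations byte-identical)
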